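import Summits.HodgeConjecture.CorCM.IrreducibleOddWeightsAdditivityHelly
import Summits.HodgeConjecture.CorCM.IrreducibleOddWeightsIndexHellyCMFields
import HarnessLib

/-!
# `Hg(∏ A_i) = ∏ Hg(A_i)` for ARBITRARY CM abelian varieties is decided on sub-products of at most
# `max_i dim Hg(A_i) + 1` factors (or `[Gal(L/ℚ) : A] + 1`, `A` abelian) — CM fields, no representation listed

COR-CM (cell `pub-hodgecm2`, binder seat `b16` gen 59, count-neutral claim INDEX BOUND, file F9 — CM fields; theorems
only, no definition, no named fact, no `sorry`).  NEW as stated, hence under `Summits/`.  HONEST FRAMING: unconditional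
statements about Deligne's combinatorial ranks `cmFamilyRank` / `cmTypeRank` (`= dim MT(∏_i A_i)`, `dim MT(A_i)`, tree
`CMTorus.mtRank_…_eq_cmFamilyRank`) for INT-4 «what is known»; `HC_CM` is neither used nor asserted.

ADDITIVITY for CM fields `K_i` with CM types `Φ_i` (abelian varieties `A_i`, POSSIBLY DEGENERATE — Weil type etc.):
`cmFamilyRank Φ + |I| = Σ_i cmTypeRank Φ_i + 1`, i.e. `dim MT(∏ A_i) − 1 = Σ_i (dim MT(A_i) − 1)`, i.e.
`Hg(∏_i A_i) = ∏_i Hg(A_i)` (always `≤`, tree `CMAlgebra.cmFamilyRank_add_card_le_sum` = Moonen–Zarhin (3.1)).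

* **`cmFamilyRank_add_card_eq_iff_forall_card_le_of_cmTypeRank_le`** — if `cmTypeRank Φ_i ≤ q + 1` for all `i`
  (`dim Hg(A_i) ≤ q`), then `Hg(∏_{i∈I} A_i) = ∏ Hg(A_i)` IFF `Hg(∏_{i∈T} A_i) = ∏_{i∈T} Hg(A_i)` for every non-empty `T`
  with `|T| ≤ q + 1`; **`…_of_finrank_le`** — `[K_i:ℚ] ≤ 2q` (`dim A_i ≤ q`) suffices;
  **`exists_card_le_cmFamilyRank_add_card_ne_of_cmTypeRank_le`** — a non-additive family has a non-additive sub-family of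
  at most `q + 1` members.
* **`cmFamilyRank_add_card_eq_iff_forall_card_le_index_succ`** — `K_i ↪ L` Galois, `A ≤ Gal(L/ℚ)` with pairwise commuting
  elements: sub-families of at most `[Gal(L/ℚ) : A] + 1` members decide additivity (`L` abelian: pairs).
* **`card_le_cmTypeRank_of_minimal_nonadditive`** — in a MINIMAL non-additive family `T₀` (non-additive, every proper
  non-empty sub-family additive) EVERY member has `cmTypeRank Φ_i = dim MT(A_i) ≥ |T₀|`: an interaction of Hodge groups
  that needs `m` factors needs every factor to have `dim Hg(A_i) ≥ m − 1`; with a CM elliptic curve or any `A_i` with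
  `dim Hg(A_i) = 1` in `T₀`: `|T₀| ≤ 2`.

## References

* [MoonenZarhin1999LowDim] B. Moonen, Yu. Zarhin, *Hodge classes on abelian varieties of low dimension*, Math. Ann.
  315 (1999), §3 (3.1).
* [Mai1989] L. Mai, *Lower bounds for the ranks of CM types*, J. Number Theory 32 (1989), §2 Prop. 1 (proof).
* [Gordon1999HodgeAVSurvey] B. B. Gordon, *A survey of the Hodge conjecture for abelian varieties*, 7.5–7.7.
* [Shimura1998] G. Shimura, *Abelian Varieties with Complex Multiplication and Modular Functions*, §8.1, §32.10 Prop.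
* [Serre1977] J.-P. Serre, *Linear Representations of Finite Groups*, GTM 42 (1977), §3.1 Cor. to Thm. 9.
-/

set_option autoImplicit false

noncomputable section

open scoped BigOperators

open NumberField

universe u v w

namespace Summit.HodgeConjecture.CorCM

namespace IrrOdd

open Literature.NumberTheory.ComplexMultiplication

variable {G : Type w} [Group G] {I : Type u} {E : I → Type v} [∀ i, MulAction G (E i)] [∀ i, Fintype (E i)]

omit [∀ i, Fintype (E i)] in
/-- The empty sub-family is additive (`U(∅) = 0`). [folklore] -/
theorem finrank_antiSpan_sigmaType_coe_empty_eq_sum (Φ : ∀ i, Set (E i)) :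
    Module.finrank ℚ (antiSpan G (sigmaType fun j : ((∅ : Finset I) : Set I) => Φ j)) =
      ∑ j : ((∅ : Finset I) : Set I), Module.finrank ℚ (antiSpan G (Φ j)) := by
  haveI : IsEmpty ((∅ : Finset I) : Set I) := by simp
  rw [Fintype.sum_empty]
  have h0 : antiSpan G (sigmaType fun j : ((∅ : Finset I) : Set I) => Φ j) = ⊥ := by
    rw [Submodule.eq_bot_iff]
    intro f _
    funext x
    exact isEmptyElim x.1
  rw [h0, finrank_bot]

end IrrOdd

open Literature.NumberTheory.ComplexMultiplication
open Literature.AlgebraicGeometry.Motives (CMType)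
open Literature.AlgebraicGeometry.Pohlmann1968

variable {I : Type} [Fintype I] {K : I → Type} [∀ i, Field (K i)] [∀ i, NumberField (K i)] [∀ i, IsCMField (K i)]
  {L : Type} [Field L] [NumberField L] [Normal ℚ L]

/-! ### §0 The dictionary: additivity of a sub-family in Deligne's ranks versus `dim U` -/

omit [Fintype I] in
/-- For a non-empty sub-family `T`: `cmFamilyRank(Φ|_T) + |T| = Σ_{j∈T} cmTypeRank Φ_j + 1` (additivity,
`Hg(∏_T A_j) = ∏_T Hg(A_j)`) iff `dim U(Σ_T) = Σ_{j∈T} dim U(Φ_j)`. [cite: Shimura1998, §32.10 Prop.] [cite: Gordon1999HodgeAVSurvey, 7.7] -/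
theorem cmFamilyRank_add_card_eq_iff_finrank_eq (Φ : ∀ i, CMType (K i)) (T : Finset I) (hT : T.Nonempty) :
    CMAlgebra.cmFamilyRank (K := fun j : (T : Set I) => K j) (fun j => Φ j) + T.card =
        (∑ j ∈ T, cmTypeRank (Φ j)) + 1 ↔
      Module.finrank ℚ (antiSpan (ℂ ≃+* ℂ) (sigmaType fun j : (T : Set I) => (Φ j).1)) =
        ∑ j : (T : Set I), Module.finrank ℚ (antiSpan (ℂ ≃+* ℂ) (Φ j).1) := by
  obtain ⟨i₁, hi₁⟩ := hT
  obtain ⟨s₁⟩ : Nonempty (K i₁ →+* ℂ) := inferInstance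
  haveI : Nonempty (Σ j : (T : Set I), (K j →+* ℂ)) := ⟨⟨⟨i₁, hi₁⟩, s₁⟩⟩
  have hfam : CMAlgebra.cmFamilyRank (K := fun j : (T : Set I) => K j) (fun j => Φ j) =
      Module.finrank ℚ (antiSpan (ℂ ≃+* ℂ) (sigmaType fun j : (T : Set I) => (Φ j).1)) + 1 :=
    (IsCMTypeWith.sigmaType fun j : (T : Set I) => isCMTypeWith_conj (Φ j)).typeRank_eq_finrank_antiSpan_add_one
  have hmem : ∀ j, cmTypeRank (Φ j) = Module.finrank ℚ (antiSpan (ℂ ≃+* ℂ) (Φ j).1) + 1 := fun j =>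
    (isCMTypeWith_conj (Φ j)).typeRank_eq_finrank_antiSpan_add_one
  have hsum : ∑ j : (T : Set I), Module.finrank ℚ (antiSpan (ℂ ≃+* ℂ) (Φ j).1) =
      ∑ j ∈ T, Module.finrank ℚ (antiSpan (ℂ ≃+* ℂ) (Φ j).1) :=
    Finset.sum_coe_sort T fun j => Module.finrank ℚ (antiSpan (ℂ ≃+* ℂ) (Φ j).1)
  rw [hfam, hsum, Finset.sum_congr rfl fun j _ => hmem j, Finset.sum_add_distrib, Finset.sum_const, smul_eq_mul, mul_one]
  omega

/-- The whole family: `cmFamilyRank Φ + |I| = Σ_i cmTypeRank Φ_i + 1` iff `dim U(Σ) = Σ_i dim U(Φ_i)`.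
[cite: Shimura1998, §32.10 Prop.] [cite: Gordon1999HodgeAVSurvey, 7.7] -/
theorem cmFamilyRank_add_card_eq_iff_finrank_eq_univ [Nonempty I] (Φ : ∀ i, CMType (K i)) :
    CMAlgebra.cmFamilyRank Φ + Fintype.card I = (∑ i, cmTypeRank (Φ i)) + 1 ↔
      Module.finrank ℚ (antiSpan (ℂ ≃+* ℂ) (sigmaType fun i => (Φ i).1)) =
        ∑ i, Module.finrank ℚ (antiSpan (ℂ ≃+* ℂ) (Φ i).1) := by
  obtain ⟨i₀⟩ := ‹Nonempty I›
  obtain ⟨s₀⟩ : Nonempty (K i₀ →+* ℂ) := inferInstance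
  haveI : Nonempty (Σ i, (K i →+* ℂ)) := ⟨⟨i₀, s₀⟩⟩
  have hfam : CMAlgebra.cmFamilyRank Φ =
      Module.finrank ℚ (antiSpan (ℂ ≃+* ℂ) (sigmaType fun i => (Φ i).1)) + 1 :=
    (IsCMTypeWith.sigmaType fun i => isCMTypeWith_conj (Φ i)).typeRank_eq_finrank_antiSpan_add_one
  have hmem : ∀ j, cmTypeRank (Φ j) = Module.finrank ℚ (antiSpan (ℂ ≃+* ℂ) (Φ j).1) + 1 := fun j =>
    (isCMTypeWith_conj (Φ j)).typeRank_eq_finrank_antiSpan_add_one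
  rw [hfam, Finset.sum_congr rfl fun j _ => hmem j, Finset.sum_add_distrib, Finset.sum_const, Finset.card_univ,
    smul_eq_mul, mul_one]
  omega

/-! ### §1 `Hg(∏ A_i) = ∏ Hg(A_i)` is decided on sub-products of at most `max_i dim Hg(A_i) + 1` factors -/

/-- **ADDITIVITY OF HODGE GROUPS IS DECIDED ON SUB-PRODUCTS OF AT MOST `q + 1` FACTORS, `q ≥ max_i dim Hg(A_i)`** — CM
fields `K_i`, arbitrary CM types `Φ_i` (degenerate allowed) with `cmTypeRank Φ_i ≤ q + 1` (`dim MT(A_i) ≤ q + 1`):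
`Hg(∏_{i∈I} A_i) = ∏ Hg(A_i)` (rank additivity) IFF for every non-empty `T ⊆ I` with `|T| ≤ q + 1`,
`Hg(∏_{i∈T} A_i) = ∏_{i∈T} Hg(A_i)`.  No Galois group, representation or character is listed.
[cite: MoonenZarhin1999LowDim, §3 (3.1)] [cite: Mai1989, §2 Prop. 1 (proof)] [cite: Gordon1999HodgeAVSurvey, 7.7] -/
theorem cmFamilyRank_add_card_eq_iff_forall_card_le_of_cmTypeRank_le [Nonempty I] (Φ : ∀ i, CMType (K i)) (q : ℕ)
    (hq : ∀ i, cmTypeRank (Φ i) ≤ q + 1) :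
    CMAlgebra.cmFamilyRank Φ + Fintype.card I = (∑ i, cmTypeRank (Φ i)) + 1 ↔
      ∀ T : Finset I, T.Nonempty → T.card ≤ q + 1 →
        CMAlgebra.cmFamilyRank (K := fun j : (T : Set I) => K j) (fun j => Φ j) + T.card =
          (∑ j ∈ T, cmTypeRank (Φ j)) + 1 := by
  haveI : ∀ i, Nonempty (K i →+* ℂ) := fun i => inferInstance
  have hq' : ∀ i, Module.finrank ℚ (antiSpan (ℂ ≃+* ℂ) (Φ i).1) ≤ q := fun i => by
    have h1 : cmTypeRank (Φ i) = Module.finrank ℚ (antiSpan (ℂ ≃+* ℂ) (Φ i).1) + 1 :=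
      (isCMTypeWith_conj (Φ i)).typeRank_eq_finrank_antiSpan_add_one
    have h2 := hq i
    omega
  rw [cmFamilyRank_add_card_eq_iff_finrank_eq_univ,
    IrrOdd.finrank_antiSpan_sigmaType_eq_sum_iff_forall_card_le_of_finrank_antiSpan_le (G := ℂ ≃+* ℂ)
      (fun i => (Φ i).1) q hq']
  refine ⟨fun H T hT hTc => (cmFamilyRank_add_card_eq_iff_finrank_eq Φ T hT).2 (H T hTc), fun H T hTc => ?_⟩
  by_cases hT : T.Nonempty
  · exact (cmFamilyRank_add_card_eq_iff_finrank_eq Φ T hT).1 (H T hT hTc)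
  · rw [Finset.not_nonempty_iff_eq_empty.1 hT]
    exact IrrOdd.finrank_antiSpan_sigmaType_coe_empty_eq_sum (G := ℂ ≃+* ℂ) fun i => (Φ i).1

/-- **`dim A_i ≤ q` for all `i` suffices** (`cmTypeRank Φ_i ≤ [K_i:ℚ]/2 + 1`): for CM abelian varieties of dimension
`≤ q` — elliptic curves `q = 1`, surfaces `q = 2`, … — `Hg(∏ A_i) = ∏ Hg(A_i)` iff so on all sub-products of at most
`q + 1` factors, WHATEVER the CM types (degenerate allowed). [cite: Shimura1998, §32.10 Prop.]
[cite: MoonenZarhin1999LowDim, §3 (3.1)] [cite: Mai1989, §2 Prop. 1 (proof)] -/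
theorem cmFamilyRank_add_card_eq_iff_forall_card_le_of_finrank_le [Nonempty I] (Φ : ∀ i, CMType (K i)) (q : ℕ)
    (hq : ∀ i, Module.finrank ℚ (K i) ≤ 2 * q) :
    CMAlgebra.cmFamilyRank Φ + Fintype.card I = (∑ i, cmTypeRank (Φ i)) + 1 ↔
      ∀ T : Finset I, T.Nonempty → T.card ≤ q + 1 →
        CMAlgebra.cmFamilyRank (K := fun j : (T : Set I) => K j) (fun j => Φ j) + T.card =
          (∑ j ∈ T, cmTypeRank (Φ j)) + 1 :=
  cmFamilyRank_add_card_eq_iff_forall_card_le_of_cmTypeRank_le Φ q fun i => by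
    have h1 := cmTypeRank_le (Φ i)
    have h2 := hq i
    omega

/-- **A non-additive family has a non-additive sub-family of at most `q + 1` members** (`cmTypeRank Φ_i ≤ q + 1`):
`Hg(∏ A_i) ⊊ ∏ Hg(A_i)` is witnessed on a product of at most `q + 1` of the factors.
[cite: MoonenZarhin1999LowDim, §3 (3.1)] [cite: Mai1989, §2 Prop. 1 (proof)] -/
theorem exists_card_le_cmFamilyRank_add_card_ne_of_cmTypeRank_le [Nonempty I] (Φ : ∀ i, CMType (K i)) (q : ℕ)
    (hq : ∀ i, cmTypeRank (Φ i) ≤ q + 1)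
    (hnot : CMAlgebra.cmFamilyRank Φ + Fintype.card I ≠ (∑ i, cmTypeRank (Φ i)) + 1) :
    ∃ T : Finset I, T.Nonempty ∧ T.card ≤ q + 1 ∧
      CMAlgebra.cmFamilyRank (K := fun j : (T : Set I) => K j) (fun j => Φ j) + T.card ≠
        (∑ j ∈ T, cmTypeRank (Φ j)) + 1 := by
  by_contra hall
  push Not at hall
  exact hnot ((cmFamilyRank_add_card_eq_iff_forall_card_le_of_cmTypeRank_le Φ q hq).2 fun T hT hTc => hall T hT hTc)

/-! ### §2 The index form -/

/-- **`Hg(∏ A_i) = ∏ Hg(A_i)` IS DECIDED ON SUB-PRODUCTS OF AT MOST `[Gal(L/ℚ) : A] + 1` FACTORS**, `K_i ↪ L` Galois,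
`A ≤ Gal(L/ℚ)` with pairwise commuting elements; arbitrary CM types (degenerate allowed).
[cite: Serre1977, §3.1 Cor. to Thm. 9] [cite: MoonenZarhin1999LowDim, §3 (3.1)] [cite: Shimura1998, §8.1] -/
theorem cmFamilyRank_add_card_eq_iff_forall_card_le_index_succ [Nonempty I] (ι : L →+* ℂ) (e : ∀ i, K i →+* L)
    (Φ : ∀ i, CMType (K i)) (A : Subgroup (L ≃ₐ[ℚ] L)) (hA : ∀ a ∈ A, ∀ b ∈ A, a * b = b * a) :
    CMAlgebra.cmFamilyRank Φ + Fintype.card I = (∑ i, cmTypeRank (Φ i)) + 1 ↔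
      ∀ T : Finset I, T.Nonempty → T.card ≤ A.index + 1 →
        CMAlgebra.cmFamilyRank (K := fun j : (T : Set I) => K j) (fun j => Φ j) + T.card =
          (∑ j ∈ T, cmTypeRank (Φ j)) + 1 := by
  classical
  obtain ⟨r, hr, hsurj⟩ := exists_restrictHom ι
  have hindex : (A.comap r).index = A.index := A.index_comap_of_surjective hsurj
  haveI : (A.comap r).FiniteIndex := ⟨by rw [hindex]; exact Subgroup.FiniteIndex.index_ne_zero⟩
  have hmain := IrrOdd.finrank_antiSpan_sigmaType_eq_sum_iff_forall_card_le_index_succ_of_smul_comm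
    (E := fun i => K i →+* ℂ) (fun i => (Φ i).1) (A.comap r) (smul_comm_of_comap_restrictHom ι e hr A hA)
  rw [cmFamilyRank_add_card_eq_iff_finrank_eq_univ, hmain, hindex]
  refine ⟨fun H T hT hTc => (cmFamilyRank_add_card_eq_iff_finrank_eq Φ T hT).2 (H T hTc), fun H T hTc => ?_⟩
  by_cases hT : T.Nonempty
  · exact (cmFamilyRank_add_card_eq_iff_finrank_eq Φ T hT).1 (H T hT hTc)
  · rw [Finset.not_nonempty_iff_eq_empty.1 hT]
    exact IrrOdd.finrank_antiSpan_sigmaType_coe_empty_eq_sum (G := ℂ ≃+* ℂ) fun i => (Φ i).1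

/-- **`Gal(L/ℚ)` abelian: PAIRS DECIDE `Hg(∏ A_i) = ∏ Hg(A_i)`** for arbitrary CM types of subfields of `L`.
[cite: Gordon1999HodgeAVSurvey, 7.5–7.7] [cite: MoonenZarhin1999LowDim, §3 (3.1)] -/
theorem cmFamilyRank_add_card_eq_iff_forall_card_le_two_of_comm [Nonempty I] (ι : L →+* ℂ) (e : ∀ i, K i →+* L)
    (Φ : ∀ i, CMType (K i)) (hG : ∀ a b : L ≃ₐ[ℚ] L, a * b = b * a) :
    CMAlgebra.cmFamilyRank Φ + Fintype.card I = (∑ i, cmTypeRank (Φ i)) + 1 ↔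
      ∀ T : Finset I, T.Nonempty → T.card ≤ 2 →
        CMAlgebra.cmFamilyRank (K := fun j : (T : Set I) => K j) (fun j => Φ j) + T.card =
          (∑ j ∈ T, cmTypeRank (Φ j)) + 1 := by
  have h := cmFamilyRank_add_card_eq_iff_forall_card_le_index_succ ι e Φ ⊤ fun a _ b _ => hG a b
  rwa [Subgroup.index_top] at h

/-! ### §3 Minimal non-additive families: every member has `dim MT(A_i) ≥ |T₀|` -/

/-- **MINIMAL NON-ADDITIVE FAMILIES: `|T₀| ≤ cmTypeRank Φ_i = dim MT(A_i)` FOR EVERY MEMBER** — if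
`Hg(∏_{T₀} A_i) ≠ ∏_{T₀} Hg(A_i)` while every non-empty proper sub-family is additive, then every `i ∈ T₀` has
`dim Hg(A_i) ≥ |T₀| − 1`: small Hodge groups cannot take part in large minimal interactions.  Arbitrary CM types.
[cite: MoonenZarhin1999LowDim, §3 (3.1)] [cite: Mai1989, §2 Prop. 1 (proof)] [cite: Shimura1998, §32.10 Prop.] -/
theorem card_le_cmTypeRank_of_minimal_nonadditive (Φ : ∀ i, CMType (K i)) (T₀ : Finset I)
    (hnot : CMAlgebra.cmFamilyRank (K := fun j : (T₀ : Set I) => K j) (fun j => Φ j) + T₀.card ≠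
      (∑ j ∈ T₀, cmTypeRank (Φ j)) + 1)
    (hmin : ∀ T : Finset I, T ⊂ T₀ → T.Nonempty →
      CMAlgebra.cmFamilyRank (K := fun j : (T : Set I) => K j) (fun j => Φ j) + T.card =
        (∑ j ∈ T, cmTypeRank (Φ j)) + 1)
    {i : I} (hi : i ∈ T₀) : T₀.card ≤ cmTypeRank (Φ i) := by
  classical
  haveI : ∀ i, Nonempty (K i →+* ℂ) := fun i => inferInstance
  have hT₀ : T₀.Nonempty := ⟨i, hi⟩
  refine IrrOdd.card_le_typeRank_of_minimal_nonadditive (E := fun i => K i →+* ℂ) (fun i => isCMTypeWith_conj (Φ i)) T₀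
    (fun h => hnot ((cmFamilyRank_add_card_eq_iff_finrank_eq Φ T₀ hT₀).2 h)) (fun T hT => ?_) hi
  by_cases hTne : T.Nonempty
  · exact (cmFamilyRank_add_card_eq_iff_finrank_eq Φ T hTne).1 (hmin T hT hTne)
  · rw [Finset.not_nonempty_iff_eq_empty.1 hTne]
    exact IrrOdd.finrank_antiSpan_sigmaType_coe_empty_eq_sum (G := ℂ ≃+* ℂ) fun i => (Φ i).1

/-- **A member with `dim Hg(A_i) ≤ 1` (e.g. a CM ELLIPTIC CURVE, `cmTypeRank = 2`) bounds a minimal non-additive family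
by two members.** [cite: MoonenZarhin1999LowDim, §3 (3.1)] [cite: Gordon1999HodgeAVSurvey, §3 and 7.7] -/
theorem card_le_two_of_minimal_nonadditive_of_cmTypeRank_le_two (Φ : ∀ i, CMType (K i)) (T₀ : Finset I)
    (hnot : CMAlgebra.cmFamilyRank (K := fun j : (T₀ : Set I) => K j) (fun j => Φ j) + T₀.card ≠
      (∑ j ∈ T₀, cmTypeRank (Φ j)) + 1)
    (hmin : ∀ T : Finset I, T ⊂ T₀ → T.Nonempty →
      CMAlgebra.cmFamilyRank (K := fun j : (T : Set I) => K j) (fun j => Φ j) + T.card =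
        (∑ j ∈ T, cmTypeRank (Φ j)) + 1)
    {i : I} (hi : i ∈ T₀) (hrank : cmTypeRank (Φ i) ≤ 2) : T₀.card ≤ 2 :=
  (card_le_cmTypeRank_of_minimal_nonadditive Φ T₀ hnot hmin hi).trans hrank

end Summit.HodgeConjecture.CorCM

end
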